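import Literature.AlgebraicGeometry.HodgeTheory.FermatCoordinateSection
import Literature.Geometry.ComplexAnalytic.PhamBrieskornJoin
import Mathlib.Analysis.SpecialFunctions.Complex.Log
import HarnessLib

/-!
# The affine pieces `{x_k ≠ 0}` of the Fermat hypersurface are Pham–Brieskorn Milnor fibres: the chart and the coordinate rotations (Pham 1965; Milnor 1968 §9)

Family `hodge`, layer `Literature/AlgebraicGeometry/HodgeTheory`. Geometric input of the middle
degree of the named fact `hodgeClasses_algebraic_fermat` (file `FermatHodgeConjecture`; Ran,
Compositio Math. 42 (1980) §1, Prop. 1.7 (i) and Lemma 1.4; Shioda, Math. Ann. 245 (1979) §1):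
the structure of `Hⁿ(Xⁿₘ(ℂ); ℂ)` as a representation of `μₘⁿ⁺²` is read off the affine pieces
`U_k = Xⁿₘ ∖ {x_k = 0}`, which in the affine coordinates `yⱼ = x_{k.succAbove j}/x_k` are the
affine Fermat varieties `y₀ᵐ + ⋯ + yₙᵐ = -1`, i.e. (after the scaling `y ↦ η y`, `ηᵐ = -1`) the
Milnor fibre `∑ zⱼᵐ = 1` of the Pham–Brieskorn polynomial, whose (co)homology and its
`μₘⁿ⁺¹`-action are Pham's theorem / Milnor's Thm. 9.1 (tree:
`Literature/Geometry/ComplexAnalytic/PhamBrieskorn{Join,JoinPieces,JoinHomology,FibreCohomology}`).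
On the tree's carriers (`Motives.complexPointsCompl`, `hypersurfacePoint`, `diagonalMap`), for the
standard model `Xⁿₘ = SmoothHypersurface.hypersurface (fermatPolynomial ℂ n m)`, everything PROVED:

* (from `FermatCoordinateSection`: `fermatCoordHyperplane k`, the Zariski-closed subset
  `{x_k = 0} ∩ Xⁿₘ`, and `notMem_fermatCoordHyperplane_iff`);
* `fermatAffineChart k : U_k(ℂ) ≃ₜ {y ∈ ℂⁿ⁺¹ | ∑ yⱼᵐ = -1}` (the standard chart of `ℙ(ℂⁿ⁺²)`
  restricted to `Xⁿₘ(ℂ)`, inverse through `exists_hypersurfacePoint_eq`, continuity of the inverse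
  by the embedding `hypersurfacePoint`), and `affineFermatHomeomorphFibre : {∑ yⱼᵐ = -1} ≃ₜ
  PhamBrieskorn.fibre (m, …, m)` (`y ↦ η y`, `η = exp(πi/m)`);
* `diagonalMapCompl k a` — the diagonal symmetry `g_a`, `a ∈ μₘⁿ⁺²`, restricted to `U_k(ℂ)`, and
  its chart description `fermatAffineChartFun_diagonalMapCompl`:
  `y ↦ (a_{k.succAbove j} / a_k)ⱼ · y` (`chartFactor_single`: for `(1,…,ζ,…,1)`, `ζ` in slot
  `k.succAbove j`, the factor is `(1,…,ζ,…,1)`, `ζ` in slot `j`).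

The cohomological consequences (Pham/Milnor transported to `U_k(ℂ)`) are in
`FermatAffineChartCohomology`.

## References

* [Pham1965] F. Pham, Formules de Picard–Lefschetz généralisées et ramification des intégrales,
  Bull. Soc. Math. France 93 (1965) 333–367, §1.
* [Milnor1968] J. Milnor, Singular Points of Complex Hypersurfaces (1968), §9 Thm. 9.1, Lemma 9.2.
* [Ran1980] Z. Ran, Cycles on Fermat hypersurfaces, Compositio Math. 42 (1980), §1 (Lemma 1.4,
  Prop. 1.7 (i)).
* [Shioda1979HodgeFermat] T. Shioda, The Hodge conjecture for Fermat varieties, Math. Ann. 245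
  (1979) 175–184, §1.
* [SerreGAGA1956] J.-P. Serre, GAGA, Ann. Inst. Fourier 6 (1956), §2 n°5.
-/

noncomputable section

open CategoryTheory Limits AlgebraicGeometry MvPolynomial
open scoped LinearAlgebra.Projectivization

namespace Literature.AlgebraicGeometry.HodgeTheory

open Literature.AlgebraicGeometry.Motives Literature.NumberTheory.Transcendental
open Literature.AlgebraicTopology.SingularHomology Literature.Geometry.ComplexAnalytic

attribute [local instance] MvPolynomial.gradedAlgebra Motives.ProjBaseChange.algebraBase

variable {n : ℕ} {m : ℕ}

/-- The grading of `ℂ[x₀, …, x_{n+1}]` by degree (local notation). [folklore] -/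
local notation "𝓐" => MvPolynomial.homogeneousSubmodule (Fin (n + 2)) ℂ

/-- Local notation: the standard Fermat hypersurface `Xⁿₘ`. -/
local notation "𝕏" n' ", " m' => SmoothHypersurface.hypersurface (fermatPolynomial ℂ n' m')

/-- Local notation: its homogeneous-coordinate map. -/
local notation "pt" => hypersurfacePoint (SmoothHypersurface.hypersurfaceι (fermatPolynomial ℂ _ _))

/-! ### Evaluating the Fermat form -/

/-- `F(z) = ∑ᵢ zᵢᵐ` for the Fermat form. [folklore] -/
theorem eval_fermatPolynomial (z : Fin (n + 2) → ℂ) :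
    MvPolynomial.eval z (fermatPolynomial ℂ n m) = ∑ i, z i ^ m := by
  simp [fermatPolynomial, map_sum]

/-- For a homogeneous `F`, `[v] ∈ V(F) ↔ F(v) = 0` for any representative. [folklore] -/
theorem mk_mem_projZeroLocus_singleton_iff {F : MvPolynomial (Fin (n + 2)) ℂ} {d : ℕ}
    (hF : F.IsHomogeneous d) (v : Fin (n + 2) → ℂ) (hv : v ≠ 0) :
    Projectivization.mk ℂ v hv ∈ Projectivization.projZeroLocus {F} ↔ MvPolynomial.eval v F = 0 := by
  obtain ⟨c, hc⟩ := Projectivization.exists_smul_eq_mk_rep ℂ v hv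
  simp only [Projectivization.projZeroLocus, Set.mem_setOf_eq, Set.mem_singleton_iff, forall_eq,
    ← hc, Units.smul_def, Projectivization.eval_smul_of_isHomogeneous hF, mul_eq_zero,
    or_iff_right (pow_ne_zero _ c.ne_zero)]

/-- A point of `V(F)` has `F(rep) = 0`. [folklore] -/
theorem eval_rep_eq_zero_of_mem_projZeroLocus {F : MvPolynomial (Fin (n + 2)) ℂ}
    {p : ℙ ℂ (Fin (n + 2) → ℂ)} (hp : p ∈ Projectivization.projZeroLocus {F}) :
    MvPolynomial.eval p.rep F = 0 :=
  hp F (Set.mem_singleton F)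

/-! ### The coordinate hyperplane section `{x_k = 0}`: representatives -/

/-- Off `Z_k` the chosen representative has `z_k ≠ 0`. [folklore] -/
theorem rep_apply_ne_zero (k : Fin (n + 2)) (P : complexPointsCompl (𝕏 n, m) (fermatCoordHyperplane n m k)) :
    (hypersurfacePoint (SmoothHypersurface.hypersurfaceι (fermatPolynomial ℂ n m)) P.1).rep k ≠ 0 :=
  (notMem_fermatCoordHyperplane_iff k P.1).1 P.2

/-! ### The affine Fermat variety `∑ yⱼᵐ = -1` and the chart -/

variable (n m) in
/-- **The affine Fermat variety `y₀ᵐ + ⋯ + yₙᵐ = -1`** (the equation of `Xⁿₘ` in the affine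
coordinates `yⱼ = x_{k.succAbove j}/x_k` of the chart `{x_k ≠ 0}`). [cite: Ran1980, §1 Lemma 1.4] -/
def affineFermat : Set (Fin (n + 1) → ℂ) :=
  {y | ∑ j, y j ^ m = -1}

/-- Membership in the affine Fermat variety. [cite: Ran1980, §1 Lemma 1.4] -/
@[simp] theorem mem_affineFermat {y : Fin (n + 1) → ℂ} : y ∈ affineFermat n m ↔ ∑ j, y j ^ m = -1 :=
  Iff.rfl

/-- The Fermat form on a vector with `z_k ≠ 0`: `F(z)/z_kᵐ = 1 + ∑ⱼ (z_{k.succAbove j}/z_k)ᵐ`.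
[folklore] -/
theorem sum_div_pow_eq (k : Fin (n + 2)) (z : Fin (n + 2) → ℂ) (hz : z k ≠ 0) :
    ∑ j : Fin (n + 1), (z (k.succAbove j) / z k) ^ m =
      (MvPolynomial.eval z (fermatPolynomial ℂ n m)) / z k ^ m - 1 := by
  rw [eval_fermatPolynomial, Fin.sum_univ_succAbove _ k, add_div, div_self (pow_ne_zero _ hz),
    Finset.sum_div]
  simp only [div_pow]
  ring

/-- **The chart map `U_k(ℂ) → ℂⁿ⁺¹`**, `P ↦ (z_{k.succAbove j}/z_k)ⱼ`: the standard chart of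
`ℙ(ℂⁿ⁺²)` at the homogeneous coordinates of `P`. [cite: SerreGAGA1956, §2 n°5] -/
def fermatAffineChartFun (k : Fin (n + 2)) (P : complexPointsCompl (𝕏 n, m) (fermatCoordHyperplane n m k)) :
    Fin (n + 1) → ℂ :=
  Projectivization.stdChartFun k
    (hypersurfacePoint (SmoothHypersurface.hypersurfaceι (fermatPolynomial ℂ n m)) P.1)

/-- The chart map lands in the affine Fermat variety. [cite: Ran1980, §1 Lemma 1.4] -/
theorem fermatAffineChartFun_mem (k : Fin (n + 2))
    (P : complexPointsCompl (𝕏 n, m) (fermatCoordHyperplane n m k)) :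
    fermatAffineChartFun k P ∈ affineFermat n m := by
  have hrep := rep_apply_ne_zero k P
  have hF : MvPolynomial.eval (hypersurfacePoint (SmoothHypersurface.hypersurfaceι
      (fermatPolynomial ℂ n m)) P.1).rep (fermatPolynomial ℂ n m) = 0 :=
    eval_rep_eq_zero_of_mem_projZeroLocus (hypersurfacePoint_mem_projZeroLocus
      (isHomogeneous_fermatPolynomial n m) (SmoothHypersurface.range_hypersurfaceι _) P.1)
  rw [mem_affineFermat]
  simp only [fermatAffineChartFun, Projectivization.stdChartFun]
  rw [sum_div_pow_eq k _ hrep, hF, zero_div, zero_sub]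

/-- The chart map is continuous. [cite: SerreGAGA1956, §2 n°5] -/
theorem continuous_fermatAffineChartFun (k : Fin (n + 2)) :
    Continuous (fermatAffineChartFun (n := n) (m := m) k) :=
  (Projectivization.continuousOn_stdChartFun k).comp_continuous
    ((continuous_hypersurfacePoint _).comp continuous_subtype_val)
    fun P ↦ (notMem_fermatCoordHyperplane_iff k P.1).1 P.2

/-- The vector `(y₀, …, 1, …, yₙ)` (`1` in slot `k`) is a zero of the Fermat form iff `∑ yⱼᵐ = -1`.
[folklore] -/
theorem eval_insertNth_one (k : Fin (n + 2)) (y : Fin (n + 1) → ℂ) :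
    MvPolynomial.eval (Fin.insertNth k (1 : ℂ) y) (fermatPolynomial ℂ n m) = 1 + ∑ j, y j ^ m := by
  rw [eval_fermatPolynomial, Fin.sum_univ_succAbove _ k, Fin.insertNth_apply_same, one_pow]
  simp only [Fin.insertNth_apply_succAbove]

/-- **Every point of the affine Fermat variety is the chart image of a complex point of `Xⁿₘ`**
(`[y₀ : … : 1 : … : yₙ] ∈ V(F)`, and projective zeros of `F` are homogeneous coordinates of complex
points, `exists_hypersurfacePoint_eq`). [cite: SerreGAGA1956, §2 n°5] -/
theorem exists_hypersurfacePoint_eq_stdChartInv (k : Fin (n + 2)) {y : Fin (n + 1) → ℂ}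
    (hy : y ∈ affineFermat n m) : ∃ P : ComplexPoints (𝕏 n, m),
      hypersurfacePoint (SmoothHypersurface.hypersurfaceι (fermatPolynomial ℂ n m)) P =
        Projectivization.stdChartInv k y := by
  refine exists_hypersurfacePoint_eq (isHomogeneous_fermatPolynomial n m)
    (SmoothHypersurface.range_hypersurfaceι _) ?_
  rw [Projectivization.stdChartInv, mk_mem_projZeroLocus_singleton_iff (isHomogeneous_fermatPolynomial n m),
    eval_insertNth_one, mem_affineFermat.1 hy, add_neg_cancel]

/-- **The inverse chart `{∑ yⱼᵐ = -1} → U_k(ℂ)`**: the complex point with homogeneous coordinates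
`[y₀ : … : 1 : … : yₙ]`. [cite: SerreGAGA1956, §2 n°5] -/
def fermatAffineChartInv (k : Fin (n + 2)) (y : affineFermat n m) :
    complexPointsCompl (𝕏 n, m) (fermatCoordHyperplane n m k) :=
  ⟨(exists_hypersurfacePoint_eq_stdChartInv k y.2).choose, by
    rw [notMem_fermatCoordHyperplane_iff, (exists_hypersurfacePoint_eq_stdChartInv k y.2).choose_spec]
    exact Projectivization.stdChartInv_mem_stdChartSource k _⟩

/-- The inverse chart has homogeneous coordinates `[y₀ : … : 1 : … : yₙ]`. [cite: SerreGAGA1956, §2 n°5] -/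
theorem hypersurfacePoint_fermatAffineChartInv (k : Fin (n + 2)) (y : affineFermat n m) :
    hypersurfacePoint (SmoothHypersurface.hypersurfaceι (fermatPolynomial ℂ n m))
        (fermatAffineChartInv k y).1 = Projectivization.stdChartInv k y :=
  (exists_hypersurfacePoint_eq_stdChartInv k y.2).choose_spec

/-- The inverse chart is continuous (`hypersurfacePoint` is a topological embedding and
`stdChartInv` is continuous). [cite: SerreGAGA1956, §2 n°5 Lemme 1 b)] -/
theorem continuous_fermatAffineChartInv (k : Fin (n + 2)) :
    Continuous (fermatAffineChartInv (n := n) (m := m) k) := by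
  refine Continuous.subtype_mk ?_ _
  rw [(isEmbedding_hypersurfacePoint (SmoothHypersurface.hypersurfaceι
    (fermatPolynomial ℂ n m))).continuous_iff]
  exact ((Projectivization.continuous_stdChartInv k).comp continuous_subtype_val).congr
    fun y ↦ (hypersurfacePoint_fermatAffineChartInv k y).symm

/-- **The affine chart `U_k(ℂ) ≃ₜ {y ∈ ℂⁿ⁺¹ | ∑ yⱼᵐ = -1}` of the Fermat hypersurface**
(Serre, GAGA §2 n°5: the algebraic chart `D₊(x_k) ≅ 𝔸ⁿ⁺¹` is an analytic chart, read on the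
closed subvariety `Xⁿₘ`). [cite: SerreGAGA1956, §2 n°5] [cite: Ran1980, §1 Lemma 1.4] -/
def fermatAffineChart (k : Fin (n + 2)) :
    complexPointsCompl (𝕏 n, m) (fermatCoordHyperplane n m k) ≃ₜ affineFermat n m where
  toFun P := ⟨fermatAffineChartFun k P, fermatAffineChartFun_mem k P⟩
  invFun := fermatAffineChartInv k
  left_inv P := by
    refine Subtype.ext ((isEmbedding_hypersurfacePoint (SmoothHypersurface.hypersurfaceι
      (fermatPolynomial ℂ n m))).injective ?_)
    rw [hypersurfacePoint_fermatAffineChartInv]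
    exact Projectivization.stdChartInv_stdChartFun k ((notMem_fermatCoordHyperplane_iff k P.1).1 P.2)
  right_inv y := Subtype.ext (by
    change Projectivization.stdChartFun k (hypersurfacePoint _ (fermatAffineChartInv k y).1) = y
    rw [hypersurfacePoint_fermatAffineChartInv, Projectivization.stdChartFun_stdChartInv])
  continuous_toFun := (continuous_fermatAffineChartFun k).subtype_mk _
  continuous_invFun := continuous_fermatAffineChartInv k

/-- The chart on points. [cite: SerreGAGA1956, §2 n°5] -/
@[simp] theorem fermatAffineChart_apply_coe (k : Fin (n + 2))
    (P : complexPointsCompl (𝕏 n, m) (fermatCoordHyperplane n m k)) :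
    (fermatAffineChart k P : Fin (n + 1) → ℂ) = fermatAffineChartFun k P := rfl

/-! ### Scaling to the Pham–Brieskorn fibre `∑ zⱼᵐ = 1` -/

variable (m) in
/-- `η = exp(πi/m)`, an `m`-th root of `-1`. [folklore] -/
def eta : ℂ := Complex.exp (Real.pi * Complex.I / m)

/-- `ηᵐ = -1` (`m ≠ 0`). [folklore] -/
theorem eta_pow (hm : m ≠ 0) : eta m ^ m = -1 := by
  rw [eta, ← Complex.exp_nat_mul, mul_div_cancel₀ _ (Nat.cast_ne_zero.2 hm), Complex.exp_pi_mul_I]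

/-- `η ≠ 0`. [folklore] -/
theorem eta_ne_zero : eta m ≠ 0 := Complex.exp_ne_zero _

/-- `y ↦ η y` maps `{∑ yⱼᵐ = -1}` to the fibre `{∑ zⱼᵐ = 1}`. [cite: Milnor1968, §9 Lemma 9.2] -/
theorem eta_smul_mem_fibre (hm : m ≠ 0) {y : Fin (n + 1) → ℂ} (hy : y ∈ affineFermat n m) :
    eta m • y ∈ PhamBrieskorn.fibre (fun _ : Fin (n + 1) ↦ m) := by
  rw [PhamBrieskorn.mem_fibre]
  simp only [Pi.smul_apply, smul_eq_mul, mul_pow, eta_pow hm, ← Finset.mul_sum,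
    mem_affineFermat.1 hy]
  norm_num

/-- `z ↦ η⁻¹ z` maps the fibre back. [cite: Milnor1968, §9 Lemma 9.2] -/
theorem eta_inv_smul_mem_affineFermat (hm : m ≠ 0) {z : Fin (n + 1) → ℂ}
    (hz : z ∈ PhamBrieskorn.fibre (fun _ : Fin (n + 1) ↦ m)) : (eta m)⁻¹ • z ∈ affineFermat n m := by
  rw [PhamBrieskorn.mem_fibre] at hz
  rw [mem_affineFermat]
  simp only [Pi.smul_apply, smul_eq_mul, mul_pow, ← Finset.mul_sum, hz, mul_one, inv_pow, eta_pow hm]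
  norm_num

/-- **`{∑ yⱼᵐ = -1} ≃ₜ PhamBrieskorn.fibre (m, …, m)`**, `y ↦ η y`. [cite: Milnor1968, §9 Lemma 9.2] -/
def affineFermatHomeomorphFibre (hm : m ≠ 0) :
    affineFermat n m ≃ₜ PhamBrieskorn.fibre (fun _ : Fin (n + 1) ↦ m) where
  toFun y := ⟨eta m • (y : Fin (n + 1) → ℂ), eta_smul_mem_fibre hm y.2⟩
  invFun z := ⟨(eta m)⁻¹ • (z : Fin (n + 1) → ℂ), eta_inv_smul_mem_affineFermat hm z.2⟩
  left_inv y := Subtype.ext (by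
    change (eta m)⁻¹ • (eta m • (y : Fin (n + 1) → ℂ)) = y
    rw [inv_smul_smul₀ eta_ne_zero])
  right_inv z := Subtype.ext (by
    change eta m • ((eta m)⁻¹ • (z : Fin (n + 1) → ℂ)) = z
    rw [smul_inv_smul₀ eta_ne_zero])
  continuous_toFun := ((continuous_const_smul _).comp continuous_subtype_val).subtype_mk _
  continuous_invFun := ((continuous_const_smul _).comp continuous_subtype_val).subtype_mk _

/-- The scaling on points. [cite: Milnor1968, §9 Lemma 9.2] -/
@[simp] theorem affineFermatHomeomorphFibre_apply_coe (hm : m ≠ 0) (y : affineFermat n m) :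
    (affineFermatHomeomorphFibre hm y : Fin (n + 1) → ℂ) = eta m • (y : Fin (n + 1) → ℂ) := rfl

/-- **`U_k(ℂ) ≃ₜ PhamBrieskorn.fibre (m, …, m)`**: the affine piece `{x_k ≠ 0}` of the Fermat
hypersurface is the Milnor fibre of the Pham–Brieskorn polynomial `∑ zⱼᵐ`.
[cite: Pham1965, §1] [cite: Milnor1968, §9 Thm. 9.1] -/
def fermatFibreHomeomorph (hm : m ≠ 0) (k : Fin (n + 2)) :
    complexPointsCompl (𝕏 n, m) (fermatCoordHyperplane n m k) ≃ₜ
      PhamBrieskorn.fibre (fun _ : Fin (n + 1) ↦ m) :=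
  (fermatAffineChart k).trans (affineFermatHomeomorphFibre hm)

/-- The composite on points: `P ↦ η · (z_{k.succAbove j}/z_k)ⱼ`. [cite: Pham1965, §1] -/
theorem fermatFibreHomeomorph_apply_coe (hm : m ≠ 0) (k : Fin (n + 2))
    (P : complexPointsCompl (𝕏 n, m) (fermatCoordHyperplane n m k)) :
    (fermatFibreHomeomorph hm k P : Fin (n + 1) → ℂ) = eta m • fermatAffineChartFun k P := rfl

/-! ### The diagonal symmetries restricted to `U_k(ℂ)` -/

/-- The `k`-th homogeneous coordinate of `g_a P` is nonzero iff that of `P` is. [cite: Katz2009, §3] -/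
theorem diagonalMap_notMem_fermatCoordHyperplane (k : Fin (n + 2)) (a : fermatGroup n m)
    (P : complexPointsCompl (𝕏 n, m) (fermatCoordHyperplane n m k)) :
    (diagonalMap (fermatPolynomial ℂ n m) (fermatGroup_le_diagonalStabilizer m a.2) P.1).pt ∉
      fermatCoordHyperplane n m k := by
  rw [notMem_fermatCoordHyperplane_iff, hypersurfacePoint_diagonalMap,
    Projectivization.mk_mem_stdChartSource_iff]
  change ((a : Fin (n + 2) → ℂˣ) k : ℂ) * _ ≠ 0
  exact mul_ne_zero (Units.ne_zero _) (rep_apply_ne_zero k P)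

/-- **The diagonal symmetry `g_a`, `a ∈ μₘⁿ⁺²`, restricted to the affine piece `U_k(ℂ)`.**
[cite: Shioda1979HodgeFermat, §1] [cite: Katz2009, §3] -/
def diagonalMapCompl (k : Fin (n + 2)) (a : fermatGroup n m) :
    C(complexPointsCompl (𝕏 n, m) (fermatCoordHyperplane n m k),
      complexPointsCompl (𝕏 n, m) (fermatCoordHyperplane n m k)) where
  toFun P := ⟨diagonalMap (fermatPolynomial ℂ n m) (fermatGroup_le_diagonalStabilizer m a.2) P.1,
    diagonalMap_notMem_fermatCoordHyperplane k a P⟩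
  continuous_toFun := ((diagonalMap _ _).continuous.comp continuous_subtype_val).subtype_mk _

/-- `diagonalMapCompl` is `g_a` on the underlying complex points. [cite: Katz2009, §3] -/
@[simp] theorem diagonalMapCompl_apply_coe (k : Fin (n + 2)) (a : fermatGroup n m)
    (P : complexPointsCompl (𝕏 n, m) (fermatCoordHyperplane n m k)) :
    ((diagonalMapCompl k a P) : ComplexPoints (𝕏 n, m)) =
      diagonalMap (fermatPolynomial ℂ n m) (fermatGroup_le_diagonalStabilizer m a.2) P.1 := rfl

/-- The inclusion `U_k(ℂ) ↪ Xⁿₘ(ℂ)` intertwines `diagonalMapCompl k a` and `g_a`. [cite: Katz2009, §3] -/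
theorem subtype_val_comp_diagonalMapCompl (k : Fin (n + 2)) (a : fermatGroup n m) :
    (⟨Subtype.val, continuous_subtype_val⟩ : C(complexPointsCompl (𝕏 n, m) (fermatCoordHyperplane n m k),
        ComplexPoints (𝕏 n, m))).comp (diagonalMapCompl k a) =
      (diagonalMap (fermatPolynomial ℂ n m) (fermatGroup_le_diagonalStabilizer m a.2)).comp
        ⟨Subtype.val, continuous_subtype_val⟩ :=
  rfl

/-- The factor `(a_{k.succAbove j} / a_k)ⱼ` by which `g_a` acts in the affine coordinates of the
chart `{x_k ≠ 0}`. [cite: Ran1980, §1 Lemma 1.4] -/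
def chartFactor (k : Fin (n + 2)) (a : fermatGroup n m) : Fin (n + 1) → ℂ :=
  fun j ↦ ((a : Fin (n + 2) → ℂˣ) (k.succAbove j) : ℂ) / ((a : Fin (n + 2) → ℂˣ) k : ℂ)

/-- **`g_a` in the affine chart: `y ↦ (a_{k.succAbove j}/a_k)ⱼ · y`.** [cite: Ran1980, §1 Lemma 1.4] -/
theorem fermatAffineChartFun_diagonalMapCompl (k : Fin (n + 2)) (a : fermatGroup n m)
    (P : complexPointsCompl (𝕏 n, m) (fermatCoordHyperplane n m k)) :
    fermatAffineChartFun k (diagonalMapCompl k a P) = chartFactor k a * fermatAffineChartFun k P := by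
  have hrep := rep_apply_ne_zero k P
  have hak : ((a : Fin (n + 2) → ℂˣ) k : ℂ) ≠ 0 := Units.ne_zero _
  funext j
  rw [fermatAffineChartFun, diagonalMapCompl_apply_coe, hypersurfacePoint_diagonalMap,
    Projectivization.stdChartFun_mk, Pi.mul_apply, chartFactor, fermatAffineChartFun,
    Projectivization.stdChartFun]
  simp only [smul_apply_eq_mul]
  field_simp

/-- The factor of `(1, …, ζ, …, 1)` (`ζ` in slot `k.succAbove j`) is `(1, …, ζ, …, 1)` (`ζ` in
slot `j`). [folklore] -/
theorem chartFactor_single (k : Fin (n + 2)) (j : Fin (n + 1)) (ζ : rootsOfUnity m ℂ) :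
    chartFactor k (fermatGroupSingle (k.succAbove j) ζ) =
      Function.update (fun _ : Fin (n + 1) ↦ (1 : ℂ)) j ((ζ : ℂˣ) : ℂ) := by
  classical
  funext j'
  simp only [chartFactor, fermatGroupSingle, fermatGroupEquiv_apply_coe]
  rw [Pi.mulSingle_eq_of_ne (Fin.succAbove_ne k j).symm]
  rcases eq_or_ne j' j with rfl | h
  · rw [Pi.mulSingle_eq_same, Function.update_self]; simp
  · rw [Pi.mulSingle_eq_of_ne ((Fin.succAbove_right_injective (p := k)).ne h),
      Function.update_of_ne h]; simp

end Literature.AlgebraicGeometry.HodgeTheory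

end
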